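import Mathlib.Analysis.CStarAlgebra.Matrix
import Mathlib.Analysis.SpecialFunctions.Exp
import Mathlib.Algebra.GroupWithZero.Units.Fintype
import Mathlib.Data.Int.Order.Units
import Mathlib.Data.Fintype.Perm
import Literature.MathematicalPhysics.QuantumLattice.SpinSystemProofs
import HarnessLib

/-!
# Lieb–Robinson bounds and the generation of correlations (Bravyi–Hastings–Verstraete 2006)

Trunk `MathematicalPhysics/QuantumLattice`, family `hubbard` (work item `wi-09505`, wanted by
route `HubbardSuperconductivity/SignStructure` and as a barrier-catalogue candidate). The theorem of
S. Bravyi, M. B. Hastings and F. Verstraete that **local dynamics obeying a Lieb–Robinson bound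
cannot create connected correlations outside an effective light cone**: if the initial state has
exponentially clustering correlations (length `χ`) and the dynamics `O ↦ O(t)` satisfies the
Lieb–Robinson bound with velocity `v` and tail length `ξ`, then
`|⟨O_A(t) O_B(t)⟩_c| ≤ c̄ (|A| + |B|) exp[-(L - 2vt)/χ']`, `χ' = χ + 2ξ`, `L = d(A, B)`
("there is a finite velocity at which correlations can be distributed"). Everything is **proved**
(no named fact is left undischarged); the statement is also recorded as the `Prop`
`bravyiHastingsVerstraete_correlationLightCone` with its discharge `…_holds`.

## Contents

* `connCorr ω A B = ω(AB) - ω(A)ω(B)` for a linear functional `ω` on `𝔄_Λ = Op Λ q`, the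
  three-term decomposition `connCorr_eq_three_terms` and the a-priori bound `norm_connCorr_le`.
* **The finite twirl** (`signedPerm`, `twirl`, `partialTraceNormalized`, `twirl_eq_localOp`): the
  average of `U M Uᴴ` over the unitaries `U = u(π, ε) ⊗ 𝟙_{Λ∖S}`, `u(π, ε) e_j = ε_j e_{π j}` a
  signed permutation matrix of the configuration space `ℂ^(S → Fin q)`, equals the normalised
  partial trace `𝟙_S ⊗ tr_S(M)/dim 𝓗_S` and hence lies in `𝔄_{Λ∖S}` (`isSupportedOn_twirl`), has
  norm `≤ ‖M‖` (`norm_twirl_le`) and is `ε₀`-close to `M` as soon as `‖[M, U]‖ ≤ ε₀` for all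
  unitaries `U ∈ 𝔄_S` (`norm_sub_twirl_le`). This replaces the Haar integral `∫ dμ(U) U O U†` of the
  paper by a finite average (the sign average kills the entries off-diagonal in the
  `S`-configuration, the permutation average equalises the diagonal blocks), so that no measure
  theory is needed: **localisation lemma** `exists_isSupportedOn_compl_of_commutator_le`.
* `regionNbhd D X l`, the open `l`-neighbourhood of a region for a distance function `D` on the sites,
  and the light-cone geometry `sub_two_mul_le_of_mem_regionNbhd` (`d(X_(l), Y_(l)) ≥ d(X, Y) - 2l`).
* **BHV Eq. (2)** `exists_local_approx_of_commutator_bound`: a Lieb–Robinson bound for a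
  norm-non-increasing map `α` of `𝔄_Λ` makes `α(A)`, `A ∈ 𝔄_X`, approximable within
  `c |X| ‖A‖ e^{-(l - v|t|)/ξ}` by an observable of norm `≤ ‖A‖` in `𝔄_{X_(l)}`.
* **The correlation light cone**: `norm_connCorr_le_of_quasiLocal` (from Eq. (2)-type
  quasi-locality), `norm_connCorr_le_of_commutator_bound` (from the Lieb–Robinson bound, the
  statement as printed, explicit constant `2c(|X| + |Y|) + c̃`), the printed form
  `norm_connCorr_le_of_commutator_bound'` (`c̄ (|X| + |Y|)`, `c̄ = 2c + c̃`), the strictly local /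
  finite-depth-circuit case `norm_connCorr_le_of_strictlyLocal` (`ξ → 0`: separation reduced by
  twice the light-cone radius, no other loss), the named fact and its discharge, and the pure-state
  specialisation `norm_connCorr_vectorState_le_of_commutator_bound` (`vectorState ψ`,
  `norm_vectorState_le`: `|⟨ψ, Aψ⟩| ≤ ‖A‖` for a unit vector).

## Source and locators

* S. Bravyi, M. B. Hastings, F. Verstraete, *Lieb-Robinson bounds and the generation of
  correlations and topological quantum order*, Phys. Rev. Lett. **97** (2006) 050401,
  doi:10.1103/physrevlett.97.050401, arXiv:quant-ph/0603121 [BravyiHastingsVerstraete2006].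
  Locators refer to the arXiv text (the PRL has no theorem numbering): **(LR)** is the display
  `‖[O_A(t), O_B(0)]‖ ≤ c N_min ‖O_A‖ ‖O_B‖ exp(-(L - v|t|)/ξ)`; **§corr** is the paragraph "Let us
  next show that the amount of correlations that can be created by local Hamiltonian evolution
  vanishes also exponentially outside an effective lightcone"; **Eq. (2)** is its numbered display
  `‖O_A(t) - O^l_A(t)‖ ≤ c |A| exp(-(l - v|t|)/ξ)` (with `O^l_A(t) = Tr_S(O_A(t)) ⊗ 𝟙_S / Tr_S 𝟙_S`,
  `S` the spins at distance `≥ l` from `A`, proved there by the Haar twirl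
  `O^l_A(t) = ∫ dμ(U) U O_A(t) U†` and `‖O_A(t) - O_A^l(t)‖ ≤ ∫ dμ(U) ‖[U, O_A(t)]‖`); the
  conclusion is the display-free sentence "Picking the optimal `l = (χ v t + ξ L)/(χ + 2ξ)`, we
  find that the connected correlation function at time `t` is bounded by
  `c̄ (|A| + |B|) exp[-(L - 2vt)/χ']`, where `χ' = χ + 2ξ`".
* Companion: M. B. Hastings, X.-G. Wen, Phys. Rev. B **72** (2005) 045141 [HastingsWen2005]
  (quasi-adiabatic continuation; not used here). Lieb–Robinson bounds themselves: the named fact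
  `lieb_robinson` of `LiebRobinson.lean` [NachtergaeleSims2006]; they enter this file only as the
  hypothesis `hLR`.

## Faithfulness and design notes

* The paper works with a pure state `|ψ⟩` of a spin network on a graph with the graph distance and
  a unitary `U` generated by a time-dependent nearest-neighbour Hamiltonian, and *assumes* the
  Lieb–Robinson bound (LR) for it. We keep exactly this logical structure but in the natural
  generality of the argument: an arbitrary finite site set `Λ` with a pseudo-metric
  `D : Λ → Λ → ℝ` (hypotheses `0 ≤ D`, symmetry, triangle inequality — e.g. the sup-metric of
  `Site d` restricted to a volume, or `torusDist` cast to `ℝ`), an arbitrary linear functional `ω`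
  with `|ω(A)| ≤ ‖A‖` (vector states: `norm_vectorState_le`; local restrictions of infinite-volume
  states: `InfVolState.norm_expect_le_holds`), and an arbitrary norm-non-increasing map `α` of `𝔄_Λ`
  in place of `O ↦ U† O U` (for the Heisenberg dynamics of a Hermitian Hamiltonian this is
  `norm_heisenbergEvolution_holds`). The Lieb–Robinson hypothesis `hLR` is (LR) with the prefactor
  `N_min` replaced by `|X|`, which is weaker than (LR) (`N_min ≤ |X|`) and is the form the paper
  actually uses ("with `N_min` replaced by `|A|`"). Separation is expressed pointwise
  (`∀ x ∈ X, ∀ y ∈ Y, L ≤ D x y`, `0 ≤ L`) rather than through a set distance with a junk value.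
* Constants: the paper's `c, v, ξ` (LR), `c̃, χ` (clustering) are `c, v, ξ`, `c', χ` here; the
  conclusion carries the explicit constant `2c(|X| + |Y|) + c̃` obtained from the paper's
  penultimate bound `2c(|A|+|B|) e^{-(l-vt)/ξ} + c̃ e^{-(L-2l)/χ}` at the optimal `l` (both
  exponents then equal `(L - 2v|t|)/(χ + 2ξ)`, `hexp1`/`hexp2` in the proof); the printed
  `c̄ (|A| + |B|)` follows for `|X| + |Y| ≥ 1` with `c̄ = 2c + c̃`. Inside the light cone
  (`L < 2v|t|`) the clustering hypothesis is invoked at separation `0`, which is why `0 ≤ D` and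
  `0 ≤ c'` are assumed; `0 ≤ c`, `0 ≤ v` make the optimal `l` admissible (`l ≥ 0`).
* The only deviation from the printed proof is the twirl: instead of the Haar measure on the
  unitary group of `𝓗_S` we average over the finite family of signed permutation matrices, which
  has the same two properties the proof uses (each element is a unitary in `𝔄_S`; the average of
  `U M U†` is `Tr_S(M) ⊗ 𝟙/dim`, `twirl_eq_localOp`).
* Mathlib: `Matrix.l2_opNorm_mulVec`, `CStarRing.norm_mem_unitary_mul`/`norm_mul_mem_unitary`,
  `Unitary.mem_iff`, `EuclideanSpace.inner_toLp_toLp`, `norm_inner_le_norm`, `Equiv.sum_comp`,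
  `Fintype.card_perm`-free counting via the swap trick `sum_perm_symm_apply_eq`. Mathlib has no
  partial trace for `Matrix` over a Pi-type factorisation and no Lieb–Robinson vocabulary
  (`lean search --decl 'partialTrace|Lieb.Robinson'`: no matches; the tree has partial traces
  only for the Gram tables of `Barriers/QuantumAdvantage/BoundedEntanglementGram` and the
  Lieb–Robinson *statement* `lieb_robinson`); the tree's `localOp`/`IsSupportedOn` API
  (`SpinSystem`, `SpinSystemProofs`) is used throughout.
-/

noncomputable section

open Matrix Complex Finset
open scoped Matrix.Norms.L2Operator

namespace Literature.MathematicalPhysics.QuantumLattice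

variable {Λ : Type*} [Fintype Λ] [DecidableEq Λ] {q : ℕ}

/-! ### Connected correlations of a bounded linear functional -/

section ConnCorr

/-- The **connected correlation** `⟨A B⟩_c = ω(A B) - ω(A) ω(B)` of two observables in a linear
functional `ω` on `𝔄_Λ` (a state, typically). BHV06 §corr (`⟨O_A O_B⟩_c`); Nachtergaele–Sims
(2006) Thm 2. [cite: BravyiHastingsVerstraete2006, arXiv Eq. (2) ff.] -/
def connCorr (ω : Op Λ q →ₗ[ℂ] ℂ) (A B : Op Λ q) : ℂ :=
  ω (A * B) - ω A * ω B

/-- `connCorr` unfolded. [cite: BravyiHastingsVerstraete2006, arXiv Eq. (2) ff.] -/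
theorem connCorr_apply (ω : Op Λ q →ₗ[ℂ] ℂ) (A B : Op Λ q) :
    connCorr ω A B = ω (A * B) - ω A * ω B := rfl

/-- The three-term decomposition of a connected correlation along approximants `A'`, `B'`:
`⟨A B⟩_c = ⟨(A - A') B⟩_c + ⟨A' (B - B')⟩_c + ⟨A' B'⟩_c` (bilinearity). BHV06 §corr (the step
"taking into account `‖O_A^l(t)‖, ‖O_B^l(t)‖ ≤ 1` we obtain …"). [cite: BravyiHastingsVerstraete2006, arXiv Eq. (2) ff.] -/
theorem connCorr_eq_three_terms (ω : Op Λ q →ₗ[ℂ] ℂ) (A A' B B' : Op Λ q) :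
    connCorr ω A B =
      connCorr ω (A - A') B + connCorr ω A' (B - B') + connCorr ω A' B' := by
  simp only [connCorr, sub_mul, mul_sub, map_sub]
  ring

/-- A functional bounded by the operator norm has connected correlations bounded by
`2 ‖A‖ ‖B‖`. BHV06 §corr. [cite: BravyiHastingsVerstraete2006, arXiv Eq. (2) ff.] -/
theorem norm_connCorr_le {ω : Op Λ q →ₗ[ℂ] ℂ} (hω : ∀ A, ‖ω A‖ ≤ ‖A‖) (A B : Op Λ q) :
    ‖connCorr ω A B‖ ≤ 2 * ‖A‖ * ‖B‖ := by
  unfold connCorr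
  calc ‖ω (A * B) - ω A * ω B‖ ≤ ‖ω (A * B)‖ + ‖ω A * ω B‖ := norm_sub_le _ _
    _ ≤ ‖A * B‖ + ‖A‖ * ‖B‖ := by
        refine add_le_add (hω _) ?_
        rw [norm_mul]
        exact mul_le_mul (hω A) (hω B) (norm_nonneg _) (norm_nonneg _)
    _ ≤ ‖A‖ * ‖B‖ + ‖A‖ * ‖B‖ := by
        gcongr
        exact norm_mul_le _ _
    _ = 2 * ‖A‖ * ‖B‖ := by ring

end ConnCorr

/-! ### Unitaries in a C⋆-algebra have norm at most one -/

/-- `‖U‖ ≤ 1` for a unitary element of a C⋆-ring (`= 1` unless the ring is trivial).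
[folklore] -/
theorem norm_le_one_of_mem_unitary {E : Type*} [NormedRing E] [StarRing E] [CStarRing E]
    {U : E} (hU : U ∈ unitary E) : ‖U‖ ≤ 1 := by
  rcases subsingleton_or_nontrivial E with h | h
  · rw [Subsingleton.elim U 0, norm_zero]
    exact zero_le_one
  · exact (CStarRing.norm_of_mem_unitary hU).le

/-! ### Right multiplication by a local operator -/

/-- Entries of a product with a local operator on the right:
`(N · localOp B v)(ρ, τ) = Σ_γ N(ρ, γ ⊔ τ|_{Λ∖B}) v(γ, τ|_B)` (the adjoint of
`localOp_mul_apply`). Bratteli–Robinson II §6.2.1. [folklore] -/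
theorem mul_localOp_apply (B : Finset Λ) (N : Op Λ q) (v : Matrix (B → Fin q) (B → Fin q) ℂ)
    (ρ τ : TensorIndex Λ q) :
    (N * localOp B v) ρ τ = ∑ γ, N ρ (Subtype.val.extend γ τ) * v γ (fun x => τ x) := by
  have h : (N * localOp B v) ρ τ = star ((localOp B vᴴ * Nᴴ) τ ρ) := by
    rw [localOp_conjTranspose, ← conjTranspose_mul, conjTranspose_apply, star_star]
  rw [h, localOp_mul_apply]
  simp only [mulVec, dotProduct, conjTranspose_apply, star_sum, star_mul', star_star]
  exact Finset.sum_congr rfl fun γ _ => mul_comm _ _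

/-- Entries of the conjugate of `M` by local operators:
`(localOp B u · M · localOp B v)(σ, τ) = Σ_{β, γ} u(σ|_B, β) M(β ⊔ σ|_{Λ∖B}, γ ⊔ τ|_{Λ∖B}) v(γ, τ|_B)`.
Bratteli–Robinson II §6.2.1. [folklore] -/
theorem localOp_mul_mul_localOp_apply (B : Finset Λ) (u v : Matrix (B → Fin q) (B → Fin q) ℂ)
    (M : Op Λ q) (σ τ : TensorIndex Λ q) :
    (localOp B u * M * localOp B v) σ τ =
      ∑ β, u (fun x => σ x) β *
        ∑ γ, M (Subtype.val.extend β σ) (Subtype.val.extend γ τ) * v γ (fun x => τ x) := by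
  rw [mul_assoc, localOp_mul_apply]
  simp only [mulVec, dotProduct, mul_localOp_apply]

/-! ### The signed-permutation twirl on a region -/

section Twirl

variable (S : Finset Λ)

/-- The sign `ε_a ∈ {±1} ⊆ ℂ` of a sign vector `ε : ι → ℤˣ` at `a`. [folklore] -/
def unitSign {ι : Type*} (ε : ι → ℤˣ) (a : ι) : ℂ := ((ε a : ℤ) : ℂ)

/-- Signs square to one: `ε_a ε_a = 1`. [folklore] -/
@[simp] theorem unitSign_mul_self {ι : Type*} (ε : ι → ℤˣ) (a : ι) : unitSign ε a * unitSign ε a = 1 := by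
  rw [unitSign, ← Int.cast_mul, ← Units.val_mul, Int.units_mul_self, Units.val_one, Int.cast_one]

/-- Signs are real: `conj ε_a = ε_a`. [folklore] -/
@[simp] theorem star_unitSign {ι : Type*} (ε : ι → ℤˣ) (a : ι) : star (unitSign ε a) = unitSign ε a := by
  rw [unitSign, star_intCast]

/-- Orthogonality of signs: `Σ_ε ε_a ε_b = [a = b] · #{ε}` over all sign vectors
`ε : ι → {±1}` (for `a ≠ b` the involution flipping `ε_a` changes the sign of the summand).
[folklore] -/
theorem sum_unitSign_mul_unitSign {ι : Type*} [Fintype ι] [DecidableEq ι] (a b : ι) :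
    ∑ ε : ι → ℤˣ, unitSign ε a * unitSign ε b = if a = b then (Fintype.card (ι → ℤˣ) : ℂ) else 0 := by
  split_ifs with h
  · subst h
    simp only [unitSign_mul_self, sum_const, card_univ, nsmul_eq_mul, mul_one]
  · set F : (ι → ℤˣ) → ℂ := fun ε => unitSign ε a * unitSign ε b with hF
    let flip : (ι → ℤˣ) → (ι → ℤˣ) := fun ε => Function.update ε a (-ε a)
    have hflip : Function.Involutive flip := by
      intro ε
      funext i
      by_cases hi : i = a
      · subst hi
        simp [flip]
      · simp [flip, Function.update_of_ne hi]
    have hneg : ∀ ε, F (flip ε) = -F ε := by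
      intro ε
      simp only [hF, flip, unitSign, Function.update_self, Function.update_of_ne (Ne.symm h),
        Units.val_neg, Int.cast_neg, neg_mul]
    have hsum : ∑ ε, F ε = ∑ ε, F (flip ε) := (Equiv.sum_comp hflip.toPerm F).symm
    simp only [hneg, sum_neg_distrib] at hsum
    have h2 : (2 : ℂ) * ∑ ε, F ε = 0 := by linear_combination hsum
    simpa using h2

/-- Averaging over permutations: `Σ_π F(π⁻¹ a)` does not depend on `a` (reindex `π ↦ (a b) π`).
[folklore] -/
theorem sum_perm_symm_apply_eq {ι : Type*} [Fintype ι] [DecidableEq ι] {M : Type*}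
    [AddCommMonoid M] (F : ι → M) (a b : ι) :
    ∑ π : Equiv.Perm ι, F (π.symm a) = ∑ π : Equiv.Perm ι, F (π.symm b) := by
  rw [← Equiv.sum_comp (Equiv.mulLeft (Equiv.swap a b)) (fun π : Equiv.Perm ι => F (π.symm a))]
  refine Finset.sum_congr rfl fun π _ => ?_
  simp only [Equiv.coe_mulLeft, Equiv.Perm.mul_def, Equiv.symm_trans_apply, Equiv.symm_swap,
    Equiv.swap_apply_left]

/-- Averaging over permutations is averaging over points:
`#ι · Σ_π F(π⁻¹ a) = #Perm(ι) · Σ_c F(c)`. [folklore] -/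
theorem card_smul_sum_perm_symm_apply {ι : Type*} [Fintype ι] [DecidableEq ι] {M : Type*}
    [AddCommMonoid M] (F : ι → M) (a : ι) :
    Fintype.card ι • ∑ π : Equiv.Perm ι, F (π.symm a) =
      Fintype.card (Equiv.Perm ι) • ∑ c, F c := by
  calc Fintype.card ι • ∑ π : Equiv.Perm ι, F (π.symm a)
      = ∑ b : ι, ∑ π : Equiv.Perm ι, F (π.symm a) := by rw [sum_const, card_univ]
    _ = ∑ b : ι, ∑ π : Equiv.Perm ι, F (π.symm b) :=
        Finset.sum_congr rfl fun b _ => sum_perm_symm_apply_eq F a b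
    _ = ∑ π : Equiv.Perm ι, ∑ b : ι, F (π.symm b) := Finset.sum_comm
    _ = ∑ π : Equiv.Perm ι, ∑ c, F c :=
        Finset.sum_congr rfl fun π _ => π.symm.sum_comp F
    _ = Fintype.card (Equiv.Perm ι) • ∑ c, F c := by rw [sum_const, card_univ]

/-- The **signed permutation matrix** `u(π, ε) e_j = ε_j e_{π j}` on `ℂ^ι` (used with
`ι = (S → Fin q)`, the configuration space of a region `S`); the finite family `{u(π, ε)}`
replaces the Haar-random unitary of BHV06 (§corr, the twirl `∫ dμ(U) U O_A(t) U†`).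
[cite: BravyiHastingsVerstraete2006, arXiv Eq. (2) ff.] -/
def signedPerm {ι : Type*} [DecidableEq ι] (π : Equiv.Perm ι) (ε : ι → ℤˣ) : Matrix ι ι ℂ :=
  of fun i j => if π j = i then unitSign ε j else 0

/-- Entries of `signedPerm`. [cite: BravyiHastingsVerstraete2006, arXiv Eq. (2) ff.] -/
theorem signedPerm_apply {ι : Type*} [DecidableEq ι] (π : Equiv.Perm ι) (ε : ι → ℤˣ) (i j : ι) :
    signedPerm π ε i j = if π j = i then unitSign ε j else 0 := rfl

/-- `u(π, ε)` is an isometry: `uᴴ u = 1`. [folklore] -/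
theorem conjTranspose_signedPerm_mul_self {ι : Type*} [Fintype ι] [DecidableEq ι]
    (π : Equiv.Perm ι) (ε : ι → ℤˣ) : (signedPerm π ε)ᴴ * signedPerm π ε = 1 := by
  ext j j'
  rw [mul_apply, Finset.sum_eq_single (π j)]
  · by_cases h : j = j'
    · subst h
      simp [signedPerm_apply, conjTranspose_apply]
    · have hne : π j' ≠ π j := fun h' => h (π.injective h').symm
      simp [signedPerm_apply, conjTranspose_apply, hne, one_apply, h]
  · intro i _ hi
    simp [signedPerm_apply, conjTranspose_apply, Ne.symm hi]
  · intro h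
    exact absurd (mem_univ _) h

/-- `u(π, ε)` is a co-isometry: `u uᴴ = 1`. [folklore] -/
theorem signedPerm_mul_conjTranspose_self {ι : Type*} [Fintype ι] [DecidableEq ι]
    (π : Equiv.Perm ι) (ε : ι → ℤˣ) : signedPerm π ε * (signedPerm π ε)ᴴ = 1 := by
  ext i i'
  rw [mul_apply, Finset.sum_eq_single (π.symm i)]
  · by_cases h : i = i'
    · subst h
      simp [signedPerm_apply, conjTranspose_apply]
    · simp [signedPerm_apply, conjTranspose_apply, one_apply, h]
  · intro j _ hj
    have hne : π j ≠ i := fun h' => hj (by rw [← h', Equiv.symm_apply_apply])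
    simp [signedPerm_apply, hne]
  · intro h
    exact absurd (mem_univ _) h

/-- A local operator `u ⊗ 𝟙` with `u` unitary is a unitary of `𝔄_Λ`. Bratteli–Robinson II
§6.2.1. [folklore] -/
theorem localOp_mem_unitary {u : Matrix (S → Fin q) (S → Fin q) ℂ} (h₁ : uᴴ * u = 1)
    (h₂ : u * uᴴ = 1) : localOp S u ∈ unitary (Op Λ q) := by
  rw [Unitary.mem_iff, star_eq_conjTranspose, ← localOp_conjTranspose, ← localOp_mul_holds S,
    ← localOp_mul_holds S, h₁, h₂, localOp_one]
  exact ⟨rfl, rfl⟩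

/-- The twirling unitaries `U(π, ε) = u(π, ε) ⊗ 𝟙_{Λ∖S}` are unitaries of `𝔄_Λ` supported on `S`.
[cite: BravyiHastingsVerstraete2006, arXiv Eq. (2) ff.] -/
theorem localOp_signedPerm_mem_unitary (π : Equiv.Perm (S → Fin q)) (ε : (S → Fin q) → ℤˣ) :
    localOp S (signedPerm π ε) ∈ unitary (Op Λ q) :=
  localOp_mem_unitary S (conjTranspose_signedPerm_mul_self π ε)
    (signedPerm_mul_conjTranspose_self π ε)

/-- **Entries of a twirled operator**: conjugating `M` by `U(π, ε)` relabels the `S`-part of the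
row and column configurations by `π⁻¹` and multiplies by the signs,
`(U M Uᴴ)(σ, τ) = ε_{π⁻¹σ_S} ε_{π⁻¹τ_S} M(π⁻¹σ_S ⊔ σ|_{Λ∖S}, π⁻¹τ_S ⊔ τ|_{Λ∖S})`.
[cite: BravyiHastingsVerstraete2006, arXiv Eq. (2) ff.] -/
theorem twirl_apply (π : Equiv.Perm (S → Fin q)) (ε : (S → Fin q) → ℤˣ) (M : Op Λ q)
    (σ τ : TensorIndex Λ q) :
    (localOp S (signedPerm π ε) * M * (localOp S (signedPerm π ε))ᴴ) σ τ =
      unitSign ε (π.symm fun x => σ x) * unitSign ε (π.symm fun x => τ x) *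
        M (Subtype.val.extend (π.symm fun x => σ x) σ)
          (Subtype.val.extend (π.symm fun x => τ x) τ) := by
  rw [← localOp_conjTranspose, localOp_mul_mul_localOp_apply,
    Finset.sum_eq_single (π.symm fun x => σ x)]
  · rw [Finset.sum_eq_single (π.symm fun x => τ x)]
    · simp only [signedPerm_apply, conjTranspose_apply, Equiv.apply_symm_apply, if_true, star_unitSign]
      ring
    · intro γ _ hγ
      have hne : π γ ≠ fun x : S => τ x := fun h' => hγ (by rw [← h', Equiv.symm_apply_apply])
      simp [signedPerm_apply, conjTranspose_apply, hne]
    · intro h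
      exact absurd (mem_univ _) h
  · intro β _ hβ
    have hne : π β ≠ fun x : S => σ x := fun h' => hβ (by rw [← h', Equiv.symm_apply_apply])
    simp [signedPerm_apply, hne]
  · intro h
    exact absurd (mem_univ _) h

end Twirl

/-! ### The finite twirl: a conditional expectation onto `𝔄_{Λ∖S}` by unitaries of `𝔄_S` -/

section Localization

variable (S : Finset Λ)

/-- The number of twirling unitaries `N = #Perm(S → Fin q) · #((S → Fin q) → {±1})`. [folklore] -/
def twirlCard (S : Finset Λ) (q : ℕ) : ℕ :=
  Fintype.card (Equiv.Perm (S → Fin q)) * Fintype.card ((S → Fin q) → ℤˣ)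

omit [Fintype Λ] in
/-- `twirlCard S q` is positive. [folklore] -/
theorem twirlCard_pos : 0 < twirlCard S q :=
  Nat.mul_pos Fintype.card_pos Fintype.card_pos

/-- The **twirl** of `M ∈ 𝔄_Λ` over the region `S`: the average
`𝔼_S(M) = N⁻¹ Σ_{π, ε} U(π, ε) M U(π, ε)ᴴ` of the conjugates of `M` by the signed-permutation
unitaries `U(π, ε) = u(π, ε) ⊗ 𝟙_{Λ∖S}` of `𝔄_S`. It is the finite-group substitute for the Haar
twirl `O ↦ ∫ dμ(U) U O U†` of BHV06 §corr, and equals the normalised partial trace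
`𝟙_S ⊗ tr_S(M) / dim 𝓗_S` (`twirl_eq_localOp`). [cite: BravyiHastingsVerstraete2006, arXiv Eq. (2) ff.] -/
def twirl (M : Op Λ q) : Op Λ q :=
  ((twirlCard S q : ℂ))⁻¹ •
    ∑ π : Equiv.Perm (S → Fin q), ∑ ε : (S → Fin q) → ℤˣ,
      localOp S (signedPerm π ε) * M * (localOp S (signedPerm π ε))ᴴ

/-- Gluing a configuration `c` of `S` with a configuration `s` of `Λ∖S` (as the subtype of the
complement `Sᶜ`). Bratteli–Robinson II §6.2.1 (`𝓗_Λ = 𝓗_S ⊗ 𝓗_{Λ∖S}`). [folklore] -/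
def glueCompl (c : S → Fin q) (s : ↥(Sᶜ) → Fin q) : TensorIndex Λ q :=
  fun x => if h : x ∈ S then c ⟨x, h⟩ else s ⟨x, mem_compl.2 h⟩

/-- Gluing `c` with the restriction of `σ` to `Λ∖S` is Mathlib's `Subtype.val.extend c σ`.
[folklore] -/
theorem glueCompl_restrict (c : S → Fin q) (σ : TensorIndex Λ q) :
    glueCompl S c (fun x : ↥(Sᶜ) => σ x) = Subtype.val.extend c σ := by
  funext x
  by_cases hx : x ∈ S
  · rw [glueCompl, dif_pos hx, Function.extend_val_apply hx]
  · rw [glueCompl, dif_neg hx, Function.extend_val_apply' hx]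

/-- The **normalised partial trace** over `S`, as a matrix on the configurations of `Λ∖S`:
`tr_S(M)(s, t) / dim 𝓗_S = (dim 𝓗_S)⁻¹ Σ_c M(c ⊔ s, c ⊔ t)`. BHV06 §corr
(`O^l_A(t) = Tr_S(O_A(t)) ⊗ 𝟙_S / Tr_S(𝟙_S)`). [cite: BravyiHastingsVerstraete2006, arXiv Eq. (2) ff.] -/
def partialTraceNormalized (M : Op Λ q) : Matrix (↥(Sᶜ) → Fin q) (↥(Sᶜ) → Fin q) ℂ :=
  of fun s t => ((Fintype.card (S → Fin q) : ℂ))⁻¹ * ∑ c : S → Fin q,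
    M (glueCompl S c s) (glueCompl S c t)

/-- **The twirl is the normalised partial trace**:
`𝔼_S(M) = (tr_S(M) / dim 𝓗_S) ⊗ 𝟙_S ∈ 𝔄_{Λ∖S}`. Entrywise: the sign average kills the entries
that are off-diagonal in the `S`-configuration, and the permutation average equalises the
diagonal `S`-blocks. This is the identity `O^l_A(t) = ∫ dμ(U) U O_A(t) U†` of BHV06 §corr for the
finite twirl. [cite: BravyiHastingsVerstraete2006, arXiv Eq. (2) ff.] -/
theorem twirl_eq_localOp (M : Op Λ q) :
    twirl S M = localOp Sᶜ (partialTraceNormalized S M) := by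
  ext σ τ
  have hcond : (∀ y, y ∉ Sᶜ → σ y = τ y) ↔ (fun x : S => σ x) = fun x : S => τ x := by
    simp only [mem_compl, not_not, funext_iff, Subtype.forall]
  rw [localOp_apply, if_congr hcond rfl rfl, twirl, Matrix.smul_apply, Matrix.sum_apply]
  simp only [Matrix.sum_apply, twirl_apply]
  -- the sign average
  have hε : ∀ π : Equiv.Perm (S → Fin q),
      ∑ ε : (S → Fin q) → ℤˣ, unitSign ε (π.symm fun x => σ x) * unitSign ε (π.symm fun x => τ x) *
        M (Subtype.val.extend (π.symm fun x => σ x) σ)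
          (Subtype.val.extend (π.symm fun x => τ x) τ) =
      if (fun x : S => σ x) = fun x : S => τ x then
        (Fintype.card ((S → Fin q) → ℤˣ) : ℂ) *
          M (Subtype.val.extend (π.symm fun x => σ x) σ)
            (Subtype.val.extend (π.symm fun x => σ x) τ) else 0 := by
    intro π
    rw [← Finset.sum_mul, sum_unitSign_mul_unitSign]
    by_cases h : (fun x : S => σ x) = fun x : S => τ x
    · rw [if_pos h, if_pos (by rw [h]), h]
    · rw [if_neg h, if_neg (fun h' => h (π.symm.injective h')), zero_mul]
  simp only [hε]
  by_cases h : (fun x : S => σ x) = fun x : S => τ x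
  · simp only [if_pos h]
    rw [← Finset.mul_sum, partialTraceNormalized, of_apply]
    -- the permutation average
    have hπ := card_smul_sum_perm_symm_apply
      (fun c : S → Fin q => M (Subtype.val.extend c σ) (Subtype.val.extend c τ)) (fun x : S => σ x)
    simp only [nsmul_eq_mul] at hπ
    haveI : Nonempty (S → Fin q) := ⟨fun x => σ x⟩
    have hn : (Fintype.card (S → Fin q) : ℂ) ≠ 0 := Nat.cast_ne_zero.2 Fintype.card_ne_zero
    have hP : (Fintype.card (Equiv.Perm (S → Fin q)) : ℂ) ≠ 0 :=
      Nat.cast_ne_zero.2 Fintype.card_ne_zero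
    have hE : (Fintype.card ((S → Fin q) → ℤˣ) : ℂ) ≠ 0 := Nat.cast_ne_zero.2 Fintype.card_ne_zero
    have hsum : ∑ π : Equiv.Perm (S → Fin q),
        M (Subtype.val.extend (π.symm fun x => σ x) σ) (Subtype.val.extend (π.symm fun x => σ x) τ) =
        ((Fintype.card (S → Fin q) : ℂ))⁻¹ * ((Fintype.card (Equiv.Perm (S → Fin q)) : ℂ) *
          ∑ c : S → Fin q, M (Subtype.val.extend c σ) (Subtype.val.extend c τ)) := by
      rw [← hπ, ← mul_assoc, inv_mul_cancel₀ hn, one_mul]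
    simp only [glueCompl_restrict, smul_eq_mul, twirlCard, Nat.cast_mul, hsum]
    field_simp
  · simp [h]

/-- The twirl `𝔼_S(M)` is supported off `S`. BHV06 §corr (`O^l_A(t)` acts "on spins only in
the effective lightcone"). [cite: BravyiHastingsVerstraete2006, arXiv Eq. (2) ff.] -/
theorem isSupportedOn_twirl (M : Op Λ q) : IsSupportedOn (twirl S M) Sᶜ :=
  ⟨_, (twirl_eq_localOp S M).symm⟩

/-- Norm of an average: if every term of a double family is bounded by `b`, so is its mean.
[folklore] -/
theorem norm_inv_card_smul_sum_sum_le {ι κ E : Type*} [Fintype ι] [Fintype κ] [Nonempty ι] [Nonempty κ]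
    [SeminormedAddCommGroup E] [NormedSpace ℂ E] (f : ι → κ → E) {b : ℝ}
    (hf : ∀ i k, ‖f i k‖ ≤ b) :
    ‖((Fintype.card ι * Fintype.card κ : ℕ) : ℂ)⁻¹ • ∑ i, ∑ k, f i k‖ ≤ b := by
  have hne : ((Fintype.card ι * Fintype.card κ : ℕ) : ℝ) ≠ 0 :=
    Nat.cast_ne_zero.2 (Nat.mul_pos Fintype.card_pos Fintype.card_pos).ne'
  rw [norm_smul, norm_inv, Complex.norm_natCast]
  calc ((Fintype.card ι * Fintype.card κ : ℕ) : ℝ)⁻¹ * ‖∑ i, ∑ k, f i k‖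
      ≤ ((Fintype.card ι * Fintype.card κ : ℕ) : ℝ)⁻¹ * ∑ i, ∑ k, b := by
        gcongr
        exact (norm_sum_le _ _).trans (Finset.sum_le_sum fun i _ =>
          (norm_sum_le _ _).trans (Finset.sum_le_sum fun k _ => hf i k))
    _ = b := by
        rw [Nat.cast_mul] at hne ⊢
        simp only [sum_const, card_univ, nsmul_eq_mul]
        field_simp

/-- The mean of a constant double family is the constant. [folklore] -/
theorem inv_card_smul_sum_sum_const {ι κ E : Type*} [Fintype ι] [Fintype κ] [Nonempty ι] [Nonempty κ]
    [AddCommGroup E] [Module ℂ E] (M : E) :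
    ((Fintype.card ι * Fintype.card κ : ℕ) : ℂ)⁻¹ • ∑ _i : ι, ∑ _k : κ, M = M := by
  have hne : ((Fintype.card ι * Fintype.card κ : ℕ) : ℂ) ≠ 0 :=
    Nat.cast_ne_zero.2 (Nat.mul_pos Fintype.card_pos Fintype.card_pos).ne'
  rw [Nat.cast_mul] at hne
  rw [Finset.sum_const, Finset.sum_const, card_univ, card_univ, ← mul_nsmul,
    ← Nat.cast_smul_eq_nsmul ℂ, smul_smul, Nat.cast_mul, Nat.cast_mul,
    mul_comm ((Fintype.card κ : ℂ)), inv_mul_cancel₀ hne, one_smul]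

/-- The twirl does not increase the norm: `‖𝔼_S(M)‖ ≤ ‖M‖` (an average of unitary conjugates).
BHV06 §corr (`‖O^l_A(t)‖ ≤ 1`). [cite: BravyiHastingsVerstraete2006, arXiv Eq. (2) ff.] -/
theorem norm_twirl_le (M : Op Λ q) : ‖twirl S M‖ ≤ ‖M‖ := by
  have hU := fun π ε => localOp_signedPerm_mem_unitary (Λ := Λ) (q := q) S π ε
  refine norm_inv_card_smul_sum_sum_le
    (fun (π : Equiv.Perm (S → Fin q)) (ε : (S → Fin q) → ℤˣ) =>
      localOp S (signedPerm π ε) * M * (localOp S (signedPerm π ε))ᴴ) fun π ε => le_of_eq ?_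
  rw [← star_eq_conjTranspose, CStarRing.norm_mul_mem_unitary _ (Unitary.star_mem_iff.2 (hU π ε)),
    CStarRing.norm_mem_unitary_mul _ (hU π ε)]

/-- **Localisation from commutator bounds** (the mechanism of BHV06 Eq. (2)): if `M` commutes up
to `ε₀` with every unitary supported on `S`, then `M` is within `ε₀` of its twirl
`𝔼_S(M) ∈ 𝔄_{Λ∖S}`: `‖M - 𝔼_S(M)‖ ≤ N⁻¹ Σ ‖[M, U] Uᴴ‖ ≤ ε₀`. BHV06 §corr
(`‖O_A(t) - O_A^l(t)‖ ≤ ∫ dμ(U) ‖[U, O_A(t)]‖`). [cite: BravyiHastingsVerstraete2006, arXiv Eq. (2)] -/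
theorem norm_sub_twirl_le (M : Op Λ q) {ε₀ : ℝ}
    (h : ∀ U : Op Λ q, IsSupportedOn U S → U ∈ unitary (Op Λ q) → ‖M * U - U * M‖ ≤ ε₀) :
    ‖M - twirl S M‖ ≤ ε₀ := by
  have hU := fun π ε => localOp_signedPerm_mem_unitary (Λ := Λ) (q := q) S π ε
  have hM := inv_card_smul_sum_sum_const (ι := Equiv.Perm (S → Fin q)) (κ := (S → Fin q) → ℤˣ) M
  have hkey : ∀ (π : Equiv.Perm (S → Fin q)) (ε : (S → Fin q) → ℤˣ),
      M - localOp S (signedPerm π ε) * M * (localOp S (signedPerm π ε))ᴴ =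
        (M * localOp S (signedPerm π ε) - localOp S (signedPerm π ε) * M) *
          star (localOp S (signedPerm π ε)) := by
    intro π ε
    rw [sub_mul, mul_assoc M, (Unitary.mem_iff.1 (hU π ε)).2, mul_one, star_eq_conjTranspose]
  have hdiff : M - twirl S M = ((twirlCard S q : ℂ))⁻¹ •
      ∑ π : Equiv.Perm (S → Fin q), ∑ ε : (S → Fin q) → ℤˣ,
        (M - localOp S (signedPerm π ε) * M * (localOp S (signedPerm π ε))ᴴ) := by
    simp only [Finset.sum_sub_distrib, smul_sub, twirl, twirlCard]
    rw [hM]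
  rw [hdiff]
  refine norm_inv_card_smul_sum_sum_le
    (fun (π : Equiv.Perm (S → Fin q)) (ε : (S → Fin q) → ℤˣ) =>
      M - localOp S (signedPerm π ε) * M * (localOp S (signedPerm π ε))ᴴ) fun π ε => ?_
  rw [hkey, CStarRing.norm_mul_mem_unitary _ (Unitary.star_mem_iff.2 (hU π ε))]
  exact h _ (isSupportedOn_localOp S _) (hU π ε)

/-- **Localisation lemma** (BHV06 Eq. (2), abstract form). If `M ∈ 𝔄_Λ` satisfies
`‖[M, U]‖ ≤ ε₀` for every unitary `U ∈ 𝔄_S`, then there is `M' ∈ 𝔄_{Λ∖S}` with `‖M'‖ ≤ ‖M‖` and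
`‖M - M'‖ ≤ ε₀` (namely the twirl `𝔼_S(M)`, i.e. the normalised partial trace over `S`).
BHV06 Eq. (2) and the two displays following it (with the Haar integral replaced by the
finite signed-permutation twirl). [cite: BravyiHastingsVerstraete2006, arXiv Eq. (2)] -/
theorem exists_isSupportedOn_compl_of_commutator_le (S : Finset Λ) (M : Op Λ q) {ε₀ : ℝ}
    (h : ∀ U : Op Λ q, IsSupportedOn U S → U ∈ unitary (Op Λ q) → ‖M * U - U * M‖ ≤ ε₀) :
    ∃ M' : Op Λ q, IsSupportedOn M' Sᶜ ∧ ‖M'‖ ≤ ‖M‖ ∧ ‖M - M'‖ ≤ ε₀ :=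
  ⟨twirl S M, isSupportedOn_twirl S M, norm_twirl_le S M, norm_sub_twirl_le S M h⟩

end Localization

/-! ### Neighbourhoods of regions for a distance function on the sites -/

section Geometry

variable (D : Λ → Λ → ℝ)

open Classical in
/-- The open `l`-neighbourhood `X_(l) = {y : ∃ x ∈ X, D x y < l}` of a region `X` for a distance
function `D` on the sites; its complement is the set `S` of sites "having distance at least `l`
from `X`" of BHV06 §corr. [cite: BravyiHastingsVerstraete2006, arXiv Eq. (2) ff.] -/
def regionNbhd (X : Finset Λ) (l : ℝ) : Finset Λ :=
  univ.filter fun y => ∃ x ∈ X, D x y < l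

omit [DecidableEq Λ] in
/-- Membership in the `l`-neighbourhood. [cite: BravyiHastingsVerstraete2006, arXiv Eq. (2) ff.] -/
theorem mem_regionNbhd {X : Finset Λ} {l : ℝ} {y : Λ} : y ∈ regionNbhd D X l ↔ ∃ x ∈ X, D x y < l := by
  simp [regionNbhd]

/-- Sites outside the `l`-neighbourhood of `X` are at distance `≥ l` from every site of `X`.
[cite: BravyiHastingsVerstraete2006, arXiv Eq. (2) ff.] -/
theorem le_of_mem_compl_regionNbhd {X : Finset Λ} {l : ℝ} {x y : Λ} (hy : y ∈ (regionNbhd D X l)ᶜ)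
    (hx : x ∈ X) : l ≤ D x y := by
  simp only [mem_compl, mem_regionNbhd, not_exists, not_and, not_lt] at hy
  exact hy x hx

omit [DecidableEq Λ] in
/-- **Geometry of the light cones**: if `X` and `Y` are at distance `≥ L`, their
`l`-neighbourhoods are at distance `≥ L - 2l` (triangle inequality twice). BHV06 §corr (the term
`exp[-(L - 2l)/χ]`). [cite: BravyiHastingsVerstraete2006, arXiv Eq. (2) ff.] -/
theorem sub_two_mul_le_of_mem_regionNbhd (hsymm : ∀ x y, D x y = D y x)
    (htri : ∀ x y z, D x z ≤ D x y + D y z) {X Y : Finset Λ} {L l : ℝ}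
    (hL : ∀ x ∈ X, ∀ y ∈ Y, L ≤ D x y) {x' y' : Λ} (hx' : x' ∈ regionNbhd D X l)
    (hy' : y' ∈ regionNbhd D Y l) : L - 2 * l ≤ D x' y' := by
  obtain ⟨x, hx, hxx'⟩ := (mem_regionNbhd D).1 hx'
  obtain ⟨y, hy, hyy'⟩ := (mem_regionNbhd D).1 hy'
  have h1 := hL x hx y hy
  have h2 := htri x x' y
  have h3 := htri x' y' y
  rw [hsymm y' y] at h3
  linarith

end Geometry

/-! ### BHV06 Eq. (2): quasi-locality of the dynamics from a Lieb–Robinson bound -/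

section QuasiLocality

variable (D : Λ → Λ → ℝ)

/-- **BHV06 Eq. (2)** (`‖O_A(t) - O_A^l(t)‖ ≤ c |A| exp(-(l - v|t|)/ξ)`). Let `α` be a
norm-non-increasing map of `𝔄_Λ` (the Heisenberg evolution `O ↦ O(t)` for time `t`, a
finite-depth circuit, …) satisfying the Lieb–Robinson bound
`‖[α(A), B]‖ ≤ c |X| ‖A‖ ‖B‖ e^{-(L - v|t|)/ξ}` for `A ∈ 𝔄_X`, `B ∈ 𝔄_Y`, `d(X, Y) ≥ L ≥ 0`
(BHV06 display (LR), with `N_min` replaced by `|X|` as in the derivation of Eq. (2)). Then for every `l ≥ 0` the evolved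
observable `α(A)` is within `c |X| ‖A‖ e^{-(l - v|t|)/ξ}` of an observable of norm `≤ ‖A‖`
supported in the `l`-neighbourhood of `X` (namely its twirl over the complement).
[cite: BravyiHastingsVerstraete2006, arXiv Eq. (2)] -/
theorem exists_local_approx_of_commutator_bound (α : Op Λ q → Op Λ q) (hα : ∀ A, ‖α A‖ ≤ ‖A‖)
    {c v t ξ : ℝ} (hc : 0 ≤ c)
    (hLR : ∀ (X Y : Finset Λ) (A B : Op Λ q), IsSupportedOn A X → IsSupportedOn B Y →
      ∀ L : ℝ, 0 ≤ L → (∀ x ∈ X, ∀ y ∈ Y, L ≤ D x y) →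
        ‖α A * B - B * α A‖ ≤ c * X.card * ‖A‖ * ‖B‖ * Real.exp (-((L - v * |t|) / ξ)))
    (X : Finset Λ) (A : Op Λ q) (hA : IsSupportedOn A X) (l : ℝ) (hl : 0 ≤ l) :
    ∃ A' : Op Λ q, IsSupportedOn A' (regionNbhd D X l) ∧ ‖A'‖ ≤ ‖A‖ ∧
      ‖α A - A'‖ ≤ c * X.card * ‖A‖ * Real.exp (-((l - v * |t|) / ξ)) := by
  obtain ⟨A', hA', hnorm, hdist⟩ := exists_isSupportedOn_compl_of_commutator_le (regionNbhd D X l)ᶜ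
    (α A) (ε₀ := c * X.card * ‖A‖ * Real.exp (-((l - v * |t|) / ξ))) (fun U hU hUu => by
      refine (hLR X (regionNbhd D X l)ᶜ A U hA hU l hl
        (fun x hx y hy => le_of_mem_compl_regionNbhd D hy hx)).trans ?_
      calc c * X.card * ‖A‖ * ‖U‖ * Real.exp (-((l - v * |t|) / ξ))
          ≤ c * X.card * ‖A‖ * 1 * Real.exp (-((l - v * |t|) / ξ)) := by
            gcongr
            exact norm_le_one_of_mem_unitary hUu
        _ = c * X.card * ‖A‖ * Real.exp (-((l - v * |t|) / ξ)) := by rw [mul_one])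
  rw [compl_compl] at hA'
  exact ⟨A', hA', hnorm.trans (hα A), hdist⟩

end QuasiLocality

/-! ### The correlation light cone (BHV06 §corr) -/

section LightCone

variable (D : Λ → Λ → ℝ)

/-- **Correlations cannot be created faster than the Lieb–Robinson velocity** — quasi-local
form (BHV06 §corr, from Eq. (2)). Let `D` be a pseudo-metric on the sites, `ω` a linear
functional on `𝔄_Λ` with `|ω(A)| ≤ ‖A‖` (a state), and `α : 𝔄_Λ → 𝔄_Λ` a norm-non-increasing map
(the dynamics) which is *quasi-local* in the sense of BHV06 Eq. (2): every `α(A)`, `A ∈ 𝔄_X`, is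
within `c |X| ‖A‖ e^{-(l - v|t|)/ξ}` of some `A' ∈ 𝔄_{X_(l)}` with `‖A'‖ ≤ ‖A‖`, for all `l ≥ 0`.
If `ω` has exponentially clustering correlations,
`|⟨A B⟩_c| ≤ c̃ ‖A‖ ‖B‖ e^{-L/χ}` for `A ∈ 𝔄_X`, `B ∈ 𝔄_Y`, `d(X, Y) ≥ L ≥ 0`, then the
correlations *after* the dynamics obey
`|⟨α(A) α(B)⟩_c| ≤ (2c(|X| + |Y|) + c̃) ‖A‖ ‖B‖ e^{-(L - 2v|t|)/χ'}`, `χ' = χ + 2ξ`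
(BHV06 §corr: the bound `2c(|A|+|B|) e^{-(l-vt)/ξ} + c̃ e^{-(L-2l)/χ}` at the optimal
`l = (χ v t + ξ L)/(χ + 2ξ)`). [cite: BravyiHastingsVerstraete2006, arXiv Eq. (2) ff.] -/
theorem norm_connCorr_le_of_quasiLocal (hnn : ∀ x y, 0 ≤ D x y)
    (hsymm : ∀ x y, D x y = D y x) (htri : ∀ x y z, D x z ≤ D x y + D y z)
    (ω : Op Λ q →ₗ[ℂ] ℂ) (hω : ∀ A, ‖ω A‖ ≤ ‖A‖) (α : Op Λ q → Op Λ q)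
    (hα : ∀ A, ‖α A‖ ≤ ‖A‖) {c v t ξ c' χ : ℝ} (hc : 0 ≤ c) (hv : 0 ≤ v) (hξ : 0 < ξ)
    (hc' : 0 ≤ c') (hχ : 0 < χ)
    (hql : ∀ (X : Finset Λ) (A : Op Λ q), IsSupportedOn A X → ∀ l : ℝ, 0 ≤ l →
      ∃ A' : Op Λ q, IsSupportedOn A' (regionNbhd D X l) ∧ ‖A'‖ ≤ ‖A‖ ∧
        ‖α A - A'‖ ≤ c * X.card * ‖A‖ * Real.exp (-((l - v * |t|) / ξ)))
    (hcl : ∀ (X Y : Finset Λ) (A B : Op Λ q), IsSupportedOn A X → IsSupportedOn B Y →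
      ∀ L : ℝ, 0 ≤ L → (∀ x ∈ X, ∀ y ∈ Y, L ≤ D x y) →
        ‖connCorr ω A B‖ ≤ c' * ‖A‖ * ‖B‖ * Real.exp (-(L / χ)))
    (X Y : Finset Λ) (A B : Op Λ q) (hA : IsSupportedOn A X) (hB : IsSupportedOn B Y)
    (L : ℝ) (hL0 : 0 ≤ L) (hL : ∀ x ∈ X, ∀ y ∈ Y, L ≤ D x y) :
    ‖connCorr ω (α A) (α B)‖ ≤
      (2 * c * (X.card + Y.card) + c') * ‖A‖ * ‖B‖ *
        Real.exp (-((L - 2 * v * |t|) / (χ + 2 * ξ))) := by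
  -- the optimal localisation scale `l`
  set l : ℝ := (χ * (v * |t|) + ξ * L) / (χ + 2 * ξ) with hl
  have hden : 0 < χ + 2 * ξ := by linarith
  have hl0 : 0 ≤ l := div_nonneg (by positivity) hden.le
  have hexp1 : (l - v * |t|) / ξ = (L - 2 * v * |t|) / (χ + 2 * ξ) := by
    rw [hl]
    field_simp
    ring
  have hexp2 : (L - 2 * l) / χ = (L - 2 * v * |t|) / (χ + 2 * ξ) := by
    rw [hl]
    field_simp
    ring
  clear_value l
  obtain ⟨E, hE⟩ : ∃ E : ℝ, Real.exp (-((L - 2 * v * |t|) / (χ + 2 * ξ))) = E := ⟨_, rfl⟩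
  rw [hE]
  obtain ⟨A', hA', hA'n, hA'd⟩ := hql X A hA l hl0
  obtain ⟨B', hB', hB'n, hB'd⟩ := hql Y B hB l hl0
  rw [hexp1, hE] at hA'd hB'd
  -- the clustering term, at separation `max (L - 2l) 0`
  have hsep : ∀ x' ∈ regionNbhd D X l, ∀ y' ∈ regionNbhd D Y l, max (L - 2 * l) 0 ≤ D x' y' :=
    fun x' hx' y' hy' => max_le (sub_two_mul_le_of_mem_regionNbhd D hsymm htri hL hx' hy') (hnn x' y')
  have hclAB := hcl _ _ A' B' hA' hB' (max (L - 2 * l) 0) (le_max_right _ _) hsep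
  have hE3 : Real.exp (-(max (L - 2 * l) 0 / χ)) ≤ E := by
    rw [← hE, ← hexp2, Real.exp_le_exp, neg_le_neg_iff]
    exact div_le_div_of_nonneg_right (le_max_left _ _) hχ.le
  have hE0 : 0 ≤ E := hE ▸ (Real.exp_pos _).le
  -- the three terms
  have h1 : ‖connCorr ω (α A - A') (α B)‖ ≤ 2 * (c * X.card * ‖A‖ * E) * ‖B‖ := by
    refine (norm_connCorr_le hω _ _).trans ?_
    have hb : ‖α B‖ ≤ ‖B‖ := hα B
    have ha : 0 ≤ c * X.card * ‖A‖ * E := by positivity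
    exact mul_le_mul (mul_le_mul_of_nonneg_left hA'd zero_le_two) hb (norm_nonneg _)
      (mul_nonneg zero_le_two ha)
  have h2 : ‖connCorr ω A' (α B - B')‖ ≤ 2 * ‖A‖ * (c * Y.card * ‖B‖ * E) := by
    refine (norm_connCorr_le hω _ _).trans ?_
    exact mul_le_mul (mul_le_mul_of_nonneg_left hA'n zero_le_two) hB'd (norm_nonneg _)
      (mul_nonneg zero_le_two (norm_nonneg _))
  have h3 : ‖connCorr ω A' B'‖ ≤ c' * ‖A‖ * ‖B‖ * E := by
    refine hclAB.trans ?_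
    have := mul_le_mul (mul_le_mul (mul_le_mul_of_nonneg_left hA'n hc') hB'n (norm_nonneg _)
      (mul_nonneg hc' (norm_nonneg _))) hE3 (Real.exp_pos _).le
      (mul_nonneg (mul_nonneg hc' (norm_nonneg _)) (norm_nonneg _))
    exact this
  rw [connCorr_eq_three_terms ω (α A) A' (α B) B']
  calc ‖connCorr ω (α A - A') (α B) + connCorr ω A' (α B - B') + connCorr ω A' B'‖
      ≤ ‖connCorr ω (α A - A') (α B)‖ + ‖connCorr ω A' (α B - B')‖ + ‖connCorr ω A' B'‖ :=
        norm_add₃_le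
    _ ≤ 2 * (c * X.card * ‖A‖ * E) * ‖B‖ + 2 * ‖A‖ * (c * Y.card * ‖B‖ * E) +
          c' * ‖A‖ * ‖B‖ * E := add_le_add_three h1 h2 h3
    _ = (2 * c * (X.card + Y.card) + c') * ‖A‖ * ‖B‖ * E := by ring

/-- **Bravyi–Hastings–Verstraete: Lieb–Robinson bounds and the generation of correlations**
(BHV06 §corr, as printed: from the Lieb–Robinson bound and exponential clustering). Let `D` be a
pseudo-metric on the finite set of sites `Λ`, `ω` a linear functional on `𝔄_Λ` with
`|ω(A)| ≤ ‖A‖` (e.g. a state) whose connected correlations cluster exponentially with length `χ`,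
`|⟨A B⟩_c| ≤ c̃ ‖A‖ ‖B‖ e^{-L/χ}` (`A ∈ 𝔄_X`, `B ∈ 𝔄_Y`, `d(X,Y) ≥ L ≥ 0`), and let
`α : 𝔄_Λ → 𝔄_Λ` be a norm-non-increasing map (the dynamics `O ↦ O(t) = U† O U` generated by a
local time-dependent Hamiltonian, or a local circuit) obeying the Lieb–Robinson bound
`‖[α(A), B]‖ ≤ c |X| ‖A‖ ‖B‖ e^{-(L - v|t|)/ξ}` (`A ∈ 𝔄_X`, `B ∈ 𝔄_Y`, `d(X,Y) ≥ L ≥ 0`). Then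
`|⟨α(A) α(B)⟩_c| ≤ (2c(|X| + |Y|) + c̃) ‖A‖ ‖B‖ exp(-(L - 2v|t|)/χ')` with `χ' = χ + 2ξ`:
connected correlations between regions at distance `L` cannot be built up before the time
`L/2v`. [cite: BravyiHastingsVerstraete2006, arXiv Eq. (2) ff.] -/
theorem norm_connCorr_le_of_commutator_bound (hnn : ∀ x y, 0 ≤ D x y)
    (hsymm : ∀ x y, D x y = D y x) (htri : ∀ x y z, D x z ≤ D x y + D y z)
    (ω : Op Λ q →ₗ[ℂ] ℂ) (hω : ∀ A, ‖ω A‖ ≤ ‖A‖) (α : Op Λ q → Op Λ q)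
    (hα : ∀ A, ‖α A‖ ≤ ‖A‖) {c v t ξ c' χ : ℝ} (hc : 0 ≤ c) (hv : 0 ≤ v) (hξ : 0 < ξ)
    (hc' : 0 ≤ c') (hχ : 0 < χ)
    (hLR : ∀ (X Y : Finset Λ) (A B : Op Λ q), IsSupportedOn A X → IsSupportedOn B Y →
      ∀ L : ℝ, 0 ≤ L → (∀ x ∈ X, ∀ y ∈ Y, L ≤ D x y) →
        ‖α A * B - B * α A‖ ≤ c * X.card * ‖A‖ * ‖B‖ * Real.exp (-((L - v * |t|) / ξ)))
    (hcl : ∀ (X Y : Finset Λ) (A B : Op Λ q), IsSupportedOn A X → IsSupportedOn B Y →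
      ∀ L : ℝ, 0 ≤ L → (∀ x ∈ X, ∀ y ∈ Y, L ≤ D x y) →
        ‖connCorr ω A B‖ ≤ c' * ‖A‖ * ‖B‖ * Real.exp (-(L / χ)))
    (X Y : Finset Λ) (A B : Op Λ q) (hA : IsSupportedOn A X) (hB : IsSupportedOn B Y)
    (L : ℝ) (hL0 : 0 ≤ L) (hL : ∀ x ∈ X, ∀ y ∈ Y, L ≤ D x y) :
    ‖connCorr ω (α A) (α B)‖ ≤
      (2 * c * (X.card + Y.card) + c') * ‖A‖ * ‖B‖ *
        Real.exp (-((L - 2 * v * |t|) / (χ + 2 * ξ))) :=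
  norm_connCorr_le_of_quasiLocal D hnn hsymm htri ω hω α hα hc hv hξ hc' hχ
    (fun X A hA l hl => exists_local_approx_of_commutator_bound D α hα hc hLR X A hA l hl)
    hcl X Y A B hA hB L hL0 hL

/-- **BHV06 in the printed form** `|⟨O_A(t) O_B(t)⟩_c| ≤ c̄ (|A| + |B|) exp[-(L - 2vt)/χ']`
with `c̄ = 2c + c̃`, valid as soon as one of the two regions is nonempty (for `X = Y = ∅` use
`norm_connCorr_le_of_commutator_bound`, whose constant is `c̃`). [cite: BravyiHastingsVerstraete2006, arXiv Eq. (2) ff.] -/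
theorem norm_connCorr_le_of_commutator_bound' (hnn : ∀ x y, 0 ≤ D x y)
    (hsymm : ∀ x y, D x y = D y x) (htri : ∀ x y z, D x z ≤ D x y + D y z)
    (ω : Op Λ q →ₗ[ℂ] ℂ) (hω : ∀ A, ‖ω A‖ ≤ ‖A‖) (α : Op Λ q → Op Λ q)
    (hα : ∀ A, ‖α A‖ ≤ ‖A‖) {c v t ξ c' χ : ℝ} (hc : 0 ≤ c) (hv : 0 ≤ v) (hξ : 0 < ξ)
    (hc' : 0 ≤ c') (hχ : 0 < χ)
    (hLR : ∀ (X Y : Finset Λ) (A B : Op Λ q), IsSupportedOn A X → IsSupportedOn B Y →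
      ∀ L : ℝ, 0 ≤ L → (∀ x ∈ X, ∀ y ∈ Y, L ≤ D x y) →
        ‖α A * B - B * α A‖ ≤ c * X.card * ‖A‖ * ‖B‖ * Real.exp (-((L - v * |t|) / ξ)))
    (hcl : ∀ (X Y : Finset Λ) (A B : Op Λ q), IsSupportedOn A X → IsSupportedOn B Y →
      ∀ L : ℝ, 0 ≤ L → (∀ x ∈ X, ∀ y ∈ Y, L ≤ D x y) →
        ‖connCorr ω A B‖ ≤ c' * ‖A‖ * ‖B‖ * Real.exp (-(L / χ)))
    (X Y : Finset Λ) (hXY : 1 ≤ X.card + Y.card) (A B : Op Λ q) (hA : IsSupportedOn A X)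
    (hB : IsSupportedOn B Y) (L : ℝ) (hL0 : 0 ≤ L) (hL : ∀ x ∈ X, ∀ y ∈ Y, L ≤ D x y) :
    ‖connCorr ω (α A) (α B)‖ ≤
      (2 * c + c') * (X.card + Y.card) * ‖A‖ * ‖B‖ *
        Real.exp (-((L - 2 * v * |t|) / (χ + 2 * ξ))) := by
  refine (norm_connCorr_le_of_commutator_bound D hnn hsymm htri ω hω α hα hc hv hξ hc' hχ hLR hcl
    X Y A B hA hB L hL0 hL).trans ?_
  have hXY' : (1 : ℝ) ≤ X.card + Y.card := by exact_mod_cast hXY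
  have hconst : 2 * c * (X.card + Y.card) + c' ≤ (2 * c + c') * (X.card + Y.card) := by
    nlinarith
  have h0 : 0 ≤ ‖A‖ * ‖B‖ * Real.exp (-((L - 2 * v * |t|) / (χ + 2 * ξ))) := by positivity
  calc (2 * c * (X.card + Y.card) + c') * ‖A‖ * ‖B‖ *
        Real.exp (-((L - 2 * v * |t|) / (χ + 2 * ξ)))
      = (2 * c * (X.card + Y.card) + c') *
          (‖A‖ * ‖B‖ * Real.exp (-((L - 2 * v * |t|) / (χ + 2 * ξ)))) := by ring
    _ ≤ (2 * c + c') * (X.card + Y.card) *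
          (‖A‖ * ‖B‖ * Real.exp (-((L - 2 * v * |t|) / (χ + 2 * ξ)))) :=
        mul_le_mul_of_nonneg_right hconst h0
    _ = _ := by ring

/-- **Strictly local dynamics (finite-depth circuits).** If `α` maps `𝔄_X` into `𝔄_{X_(r)}`
without increasing norms — a strict light cone of radius `r`, as for the conjugation by a
depth-`n` circuit of gates of range `R` (`r = nR`, up to the convention for `<` in `regionNbhd`) — and
`ω` has `(c̃, χ)`-exponentially clustering correlations, then the correlations after `α` still
cluster with the separation reduced by `2r`: `|⟨α(A) α(B)⟩_c| ≤ c̃ ‖A‖ ‖B‖ e^{-(L - 2r)/χ}`. This is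
the `ξ → 0` case of BHV06 §corr (finite-depth local unitaries cannot create long-range connected
correlations from an exponentially clustering state; cf. the GHZ example following §corr).
[cite: BravyiHastingsVerstraete2006, arXiv Eq. (2) ff.] -/
theorem norm_connCorr_le_of_strictlyLocal (hnn : ∀ x y, 0 ≤ D x y)
    (hsymm : ∀ x y, D x y = D y x) (htri : ∀ x y z, D x z ≤ D x y + D y z)
    (ω : Op Λ q →ₗ[ℂ] ℂ) (α : Op Λ q → Op Λ q) {r c' χ : ℝ} (hc' : 0 ≤ c') (hχ : 0 < χ)
    (hloc : ∀ (X : Finset Λ) (A : Op Λ q), IsSupportedOn A X →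
      IsSupportedOn (α A) (regionNbhd D X r) ∧ ‖α A‖ ≤ ‖A‖)
    (hcl : ∀ (X Y : Finset Λ) (A B : Op Λ q), IsSupportedOn A X → IsSupportedOn B Y →
      ∀ L : ℝ, 0 ≤ L → (∀ x ∈ X, ∀ y ∈ Y, L ≤ D x y) →
        ‖connCorr ω A B‖ ≤ c' * ‖A‖ * ‖B‖ * Real.exp (-(L / χ)))
    (X Y : Finset Λ) (A B : Op Λ q) (hA : IsSupportedOn A X) (hB : IsSupportedOn B Y)
    (L : ℝ) (hL : ∀ x ∈ X, ∀ y ∈ Y, L ≤ D x y) :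
    ‖connCorr ω (α A) (α B)‖ ≤ c' * ‖A‖ * ‖B‖ * Real.exp (-((L - 2 * r) / χ)) := by
  obtain ⟨hαA, hnA⟩ := hloc X A hA
  obtain ⟨hαB, hnB⟩ := hloc Y B hB
  have hsep : ∀ x' ∈ regionNbhd D X r, ∀ y' ∈ regionNbhd D Y r, max (L - 2 * r) 0 ≤ D x' y' :=
    fun x' hx' y' hy' => max_le (sub_two_mul_le_of_mem_regionNbhd D hsymm htri hL hx' hy') (hnn x' y')
  refine (hcl _ _ _ _ hαA hαB (max (L - 2 * r) 0) (le_max_right _ _) hsep).trans ?_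
  have hE : Real.exp (-(max (L - 2 * r) 0 / χ)) ≤ Real.exp (-((L - 2 * r) / χ)) := by
    rw [Real.exp_le_exp, neg_le_neg_iff]
    exact div_le_div_of_nonneg_right (le_max_left _ _) hχ.le
  exact mul_le_mul (mul_le_mul (mul_le_mul_of_nonneg_left hnA hc') hnB (norm_nonneg _)
    (mul_nonneg hc' (norm_nonneg _))) hE (Real.exp_pos _).le
    (mul_nonneg (mul_nonneg hc' (norm_nonneg _)) (norm_nonneg _))

end LightCone

/-! ### The named fact and its discharge -/

section NamedFact

/-- **Named fact `bravyiHastingsVerstraete_correlationLightCone`** (Bravyi–Hastings–Verstraete,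
*Lieb–Robinson bounds and the generation of correlations and topological quantum order*, PRL **97**
(2006) 050401; arXiv:quant-ph/0603121, the paragraph ("§corr" in this file) "Let us next show that the amount of
correlations that can be created by local Hamiltonian evolution vanishes exponentially outside an
effective lightcone", Eq. (2) and the two displays following it). For every finite set of sites
`Λ` (in `Type`) with a pseudo-metric `D`, every norm-bounded linear functional `ω` on `𝔄_Λ`
(a state) with `(c̃, χ)`-exponential clustering, and every norm-non-increasing map `α` of `𝔄_Λ`
(the dynamics for time `t`) obeying a Lieb–Robinson bound with constants `(c, v, ξ)` and prefactor
`|X|`: `|⟨α(A) α(B)⟩_c| ≤ (2c(|X| + |Y|) + c̃) ‖A‖ ‖B‖ exp(-(d(X,Y) - 2v|t|)/(χ + 2ξ))` — "there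
is a finite velocity at which correlations can be distributed". A closed proposition (all data
quantified inside), discharged below (`bravyiHastingsVerstraete_correlationLightCone_holds`) from
`norm_connCorr_le_of_commutator_bound` (which is universe-polymorphic in `Λ`); kept as a `Prop`
so that routes and the barrier catalogue can name it. [cite: BravyiHastingsVerstraete2006, arXiv Eq. (2) ff.] -/
def bravyiHastingsVerstraete_correlationLightCone : Prop :=
  ∀ (Λ : Type) [Fintype Λ] [DecidableEq Λ] (q : ℕ) (D : Λ → Λ → ℝ), (∀ x y, 0 ≤ D x y) →
    (∀ x y, D x y = D y x) → (∀ x y z, D x z ≤ D x y + D y z) →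
  ∀ (ω : Op Λ q →ₗ[ℂ] ℂ), (∀ A, ‖ω A‖ ≤ ‖A‖) →
  ∀ (α : Op Λ q → Op Λ q), (∀ A, ‖α A‖ ≤ ‖A‖) →
  ∀ (c v t ξ c' χ : ℝ), 0 ≤ c → 0 ≤ v → 0 < ξ → 0 ≤ c' → 0 < χ →
    (∀ (X Y : Finset Λ) (A B : Op Λ q), IsSupportedOn A X → IsSupportedOn B Y →
      ∀ L : ℝ, 0 ≤ L → (∀ x ∈ X, ∀ y ∈ Y, L ≤ D x y) →
        ‖α A * B - B * α A‖ ≤ c * X.card * ‖A‖ * ‖B‖ * Real.exp (-((L - v * |t|) / ξ))) →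
    (∀ (X Y : Finset Λ) (A B : Op Λ q), IsSupportedOn A X → IsSupportedOn B Y →
      ∀ L : ℝ, 0 ≤ L → (∀ x ∈ X, ∀ y ∈ Y, L ≤ D x y) →
        ‖connCorr ω A B‖ ≤ c' * ‖A‖ * ‖B‖ * Real.exp (-(L / χ))) →
    ∀ (X Y : Finset Λ) (A B : Op Λ q), IsSupportedOn A X → IsSupportedOn B Y →
      ∀ L : ℝ, 0 ≤ L → (∀ x ∈ X, ∀ y ∈ Y, L ≤ D x y) →
        ‖connCorr ω (α A) (α B)‖ ≤
          (2 * c * (X.card + Y.card) + c') * ‖A‖ * ‖B‖ *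
            Real.exp (-((L - 2 * v * |t|) / (χ + 2 * ξ)))

/-- **Discharge of `bravyiHastingsVerstraete_correlationLightCone`** by
`norm_connCorr_le_of_commutator_bound` (finite twirl localisation + three-term decomposition +
optimal `l`). [cite: BravyiHastingsVerstraete2006, arXiv Eq. (2) ff.] -/
theorem bravyiHastingsVerstraete_correlationLightCone_holds : bravyiHastingsVerstraete_correlationLightCone :=
  fun _ _ _ _ D hnn hsymm htri ω hω α hα _ _ _ _ _ _ hc hv hξ hc' hχ hLR hcl X Y A B hA hB L hL0 hL =>
    norm_connCorr_le_of_commutator_bound D hnn hsymm htri ω hω α hα hc hv hξ hc' hχ hLR hcl X Y A B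
      hA hB L hL0 hL

end NamedFact

/-! ### Vector states -/

section VectorState

variable {n : Type*} [Fintype n]

/-- The **vector-state functional** `A ↦ ⟨ψ, A ψ⟩ = star ψ ⬝ᵥ (A *ᵥ ψ)` of a vector `ψ` (same
expression as `opExpect A ψ` of `LiebRobinson.lean` and as BHV06's `⟨ψ|O|ψ⟩`), as a `ℂ`-linear map.
BHV06 §corr. [cite: BravyiHastingsVerstraete2006, arXiv Eq. (2) ff.] -/
def vectorState (ψ : n → ℂ) : Matrix n n ℂ →ₗ[ℂ] ℂ where
  toFun A := star ψ ⬝ᵥ (A *ᵥ ψ)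
  map_add' A B := by simp only [add_mulVec, dotProduct_add]
  map_smul' c A := by simp only [smul_mulVec, dotProduct_smul, smul_eq_mul, RingHom.id_apply]

omit [Fintype Λ] [DecidableEq Λ] in
/-- `vectorState` unfolded. [cite: BravyiHastingsVerstraete2006, arXiv Eq. (2) ff.] -/
@[simp] theorem vectorState_apply (ψ : n → ℂ) (A : Matrix n n ℂ) :
    vectorState ψ A = star ψ ⬝ᵥ (A *ᵥ ψ) := rfl

omit [Fintype Λ] [DecidableEq Λ] in
/-- A unit vector gives a norm-bounded functional: `|⟨ψ, A ψ⟩| ≤ ‖A‖` (Cauchy–Schwarz and the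
`L²`-operator norm, Mathlib `Matrix.l2_opNorm_mulVec`). BHV06 §corr (`‖O_A‖ ≤ 1` normalisation).
[cite: BravyiHastingsVerstraete2006, arXiv Eq. (2) ff.] -/
theorem norm_vectorState_le [DecidableEq n] {ψ : n → ℂ} (hψ : star ψ ⬝ᵥ ψ = 1)
    (A : Matrix n n ℂ) : ‖vectorState ψ A‖ ≤ ‖A‖ := by
  let x : EuclideanSpace ℂ n := WithLp.toLp 2 ψ
  have hxx : inner ℂ x x = (1 : ℂ) := by
    change inner ℂ (WithLp.toLp 2 ψ) (WithLp.toLp 2 ψ) = 1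
    rw [EuclideanSpace.inner_toLp_toLp, dotProduct_comm]
    exact hψ
  have hnx : ‖x‖ = 1 := by
    have h2 : ‖x‖ ^ 2 = 1 := by
      have := norm_sq_eq_re_inner (𝕜 := ℂ) x
      rw [hxx] at this
      simpa using this
    have h0 : 0 ≤ ‖x‖ := norm_nonneg x
    nlinarith
  have hAx : ‖(WithLp.toLp 2 (A *ᵥ ψ) : EuclideanSpace ℂ n)‖ ≤ ‖A‖ * ‖x‖ :=
    Matrix.l2_opNorm_mulVec A x
  have hin : vectorState ψ A = inner ℂ x (WithLp.toLp 2 (A *ᵥ ψ) : EuclideanSpace ℂ n) := by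
    change star ψ ⬝ᵥ (A *ᵥ ψ) = inner ℂ (WithLp.toLp 2 ψ) (WithLp.toLp 2 (A *ᵥ ψ))
    rw [EuclideanSpace.inner_toLp_toLp, dotProduct_comm]
  rw [hin]
  calc ‖inner ℂ x (WithLp.toLp 2 (A *ᵥ ψ) : EuclideanSpace ℂ n)‖
      ≤ ‖x‖ * ‖(WithLp.toLp 2 (A *ᵥ ψ) : EuclideanSpace ℂ n)‖ := norm_inner_le_norm _ _
    _ ≤ ‖x‖ * (‖A‖ * ‖x‖) := mul_le_mul_of_nonneg_left hAx (norm_nonneg _)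
    _ = ‖A‖ := by rw [hnx, one_mul, mul_one]

/-- **BHV06 for a pure state `|ψ⟩`** (the setting of the paper): the correlation light cone for
the vector state of a unit vector `ψ`, from the Lieb–Robinson bound for `α` and exponential
clustering of `ψ`. [cite: BravyiHastingsVerstraete2006, arXiv Eq. (2) ff.] -/
theorem norm_connCorr_vectorState_le_of_commutator_bound (D : Λ → Λ → ℝ)
    (hnn : ∀ x y, 0 ≤ D x y) (hsymm : ∀ x y, D x y = D y x)
    (htri : ∀ x y z, D x z ≤ D x y + D y z) {ψ : TensorIndex Λ q → ℂ} (hψ : star ψ ⬝ᵥ ψ = 1)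
    (α : Op Λ q → Op Λ q) (hα : ∀ A, ‖α A‖ ≤ ‖A‖) {c v t ξ c' χ : ℝ} (hc : 0 ≤ c) (hv : 0 ≤ v)
    (hξ : 0 < ξ) (hc' : 0 ≤ c') (hχ : 0 < χ)
    (hLR : ∀ (X Y : Finset Λ) (A B : Op Λ q), IsSupportedOn A X → IsSupportedOn B Y →
      ∀ L : ℝ, 0 ≤ L → (∀ x ∈ X, ∀ y ∈ Y, L ≤ D x y) →
        ‖α A * B - B * α A‖ ≤ c * X.card * ‖A‖ * ‖B‖ * Real.exp (-((L - v * |t|) / ξ)))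
    (hcl : ∀ (X Y : Finset Λ) (A B : Op Λ q), IsSupportedOn A X → IsSupportedOn B Y →
      ∀ L : ℝ, 0 ≤ L → (∀ x ∈ X, ∀ y ∈ Y, L ≤ D x y) →
        ‖connCorr (vectorState ψ) A B‖ ≤ c' * ‖A‖ * ‖B‖ * Real.exp (-(L / χ)))
    (X Y : Finset Λ) (A B : Op Λ q) (hA : IsSupportedOn A X) (hB : IsSupportedOn B Y)
    (L : ℝ) (hL0 : 0 ≤ L) (hL : ∀ x ∈ X, ∀ y ∈ Y, L ≤ D x y) :
    ‖connCorr (vectorState ψ) (α A) (α B)‖ ≤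
      (2 * c * (X.card + Y.card) + c') * ‖A‖ * ‖B‖ *
        Real.exp (-((L - 2 * v * |t|) / (χ + 2 * ξ))) :=
  norm_connCorr_le_of_commutator_bound D hnn hsymm htri (vectorState ψ) (norm_vectorState_le hψ)
    α hα hc hv hξ hc' hχ hLR hcl X Y A B hA hB L hL0 hL

end VectorState

end Literature.MathematicalPhysics.QuantumLattice
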